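import Literature.MathematicalPhysics.QuantumFieldTheory.Balaban1983to89.B9Eq321FlatProjectionDictionary
import Literature.MathematicalPhysics.QuantumFieldTheory.Balaban1983to89.B5Hk164Transl
import Literature.MathematicalPhysics.QuantumFieldTheory.Balaban1983to89.B5DivOrth

/-!
# `Balaban1983to89.B5Eq190FlatFormTransfer` — T. Bałaban, *Propagators and renormalization transformations for lattice gauge theories. I*, Commun.
# Math. Phys. **95** (1984) 17–40 [Balaban1984PropagatorsI] (1.69) p. 29, against *Propagators for lattice gauge theories in a background field*
# [Balaban1985BackgroundPropagators] (3.10), (3.21)–(3.26) pp. 392–395: THE QUADRATIC FORM OF THE pub-balaban NE9 CHAIN'S FLAT PRINCIPAL GAUGE-FIXED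
# OPERATOR ON SCALAR FIELDS IS, UNDER THE SITE DICTIONARY, `c₀(ηL)^{−2}` TIMES THE QUADRATIC FORM (1.69) OF b05's `Δ_{a″}`, `a″ = a·c₁·(ηL)²∕(c₀L^d)` —
# square by square: the curl energy, the projected divergence, the averaging term

statement-level skeleton of published theorems with citation tags; proofs where landed; nothing here is a claim about the Yang–Mills mass gap

THE PRINT (verbatim, [B5] p. 29): *«⟨A, Δ_a A⟩ = ⟨A, ∂*∂A⟩ + ⟨A, ∂R∂*A⟩ + a⟨A, Q*QA⟩ = ⟨A, ΔA⟩ − ⟨A, ∂P∂*A⟩ + a⟨A, Q*QA⟩, (1.69) Δ = ∂*∂ + ∂∂*,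
R = I − P»*; [B9] p. 395: *«It coincides with Δ_a in (2.19) [of Propagators II] if U = 1»* (quoted from the tree's `B5Eq172HodgePositivity`).

WHY THIS FILE (cell context).  Item (B3) of the NE9 leaf-03 OFFER O-ne9leaf03-g58-1 ∕ INTENT I-ne9leaf03-g59-1: with (B1) `B9Eq315FlatDictionary` and
(B2) `B9Eq321FlatProjectionDictionary` in hand, transporting b05's UNIFORM flat coercivity [B5] (1.90) (`B5DeltaA169.smul_LapOne_le_DeltaA`) to the
chain's letters (`B5Eq190FlatCoercivityUniform`) reduces to matching the three squares of (1.69) on the b05 carrier (`B5Hk164Transl.re_form_DeltaA`: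
`re⟨A, Δ_aA⟩ = cEnergy A + Σ‖R∂*A‖² + a·n^d·Σ‖Q_kA‖²`) with the three squares of the chain's `re⟨x, Δ_{1,a}x⟩ = re⟨x, D*Dx⟩ + ‖R(1)D*x‖² + a‖Q(1)x‖²`
(`B5Eq172HodgePositivity.re_inner_laplaceAK_projR`) for pulled-back scalar bond functions `x = A ∘ cast`.  This file does the three squares.

WHAT IS PROVED (sorry-free; 0 `def`; scalar fields `W = 𝔸 = ℂ`, `φ = LinearEquiv.refl ℂ ℂ`, flat `U ≡ 1`; no inequality of the papers).
* §1 **`covCurl_flat_pullback`** (the chain's flat plaquette field (3.4) of a pulled-back bond function is b05's `Fs` (1.2) at the same scalar),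
  `Fs_rescale`; §2 `sum_dirPair_eq_half_sum` (pairs `μ < ν` against ordered pairs); §3 **`re_inner_principalOpK_one_pullback`**: `re⟨f, D*D(1) f⟩ =
  c₀·(ηL)^{−2}·cEnergy L m A` for `f = A ∘ cast` (`B5Eq172HodgePositivity.re_inner_principalOpK_one` + `B5Hk164Transl.cEnergy_eq`).
* §4 **`norm_sq_QtorusW_one_pullback`**: `‖Q(1)f‖²_{L²(c₁)} = c₁·Σ |(QvOp A)(y,κ)|²` (`B9Eq315FlatDictionary.QvOp_mulVec_eq_QtorusLin_one`).
* §5 `covDerivL2K_scalar` ∕ `covDivL2K_scalar` ∕ `covLaplaceSiteK_scalar` (linearity in the scalar), **`RofU_one_eq_of_ne_zero`** (`R(1)` does not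
  depend on `η ≠ 0`), **`norm_sq_RofU_covDiv_pullback`**: `‖R(1)D*(1)f‖² = c₀·(ηL)^{−2}·Σ |(RdivS A)(x)|²`
  ((B1) §5 `D* ↔ GradOpᴴ` + (B2) `R(1) = 1 − PcT` on the mean-zero divergence).
* §6 `norm_sq_pullback`, **`re_inner_laplaceA_one_pullback`** — (1.69) UNDER THE DICTIONARY: `re⟨f, (D*D + D R(1) D* + aQ(1)†Q(1)) f⟩ =
  c₀(ηL)^{−2}·cEnergy A + c₀(ηL)^{−2}·Σ‖RdivS A‖² + a·c₁·Σ‖QvOp A‖²` for `f = A ∘ cast`.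
MODEL / DECLARED READINGS.  (M1) one averaging step (`n = L`), scalar fields, fine weight `c₀`, coarse weight `c₁`, scalar `η⁻¹`; the flat
regularity letters `hα1′ ∕ hU1′ ∕ hreg′` of `QtorusW` FREE.  (M2) none of the papers' hypotheses displayed.  (M3) NOT HERE: (1.90) itself and the
`𝔤ᶜ`-valued fields (`B5Eq190FlatCoercivityUniform`, `B5Eq172FlatFibreNaturality`); backgrounds `U ≠ 1`.
HONEST SCOPE.  [folklore] bookkeeping between two typed carriers of the same printed lattice; nothing of (1.89)–(1.90) or [B9] Thm 3.11 is asserted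
or transported in THIS file; NOT summit progress (cell pub-balaban: NE9 NOT PRINTED ∕ NOT PROVED; «NE9 ⇐ the named binders»; spine PROVED 0/9; HONEST
DEPENDENCY: continuum YM on T⁴ ⇐ BetaPertH ∧ nine spine estimates (0/9 proved); BetaPertH ⇐ (D1) ∧ (D4) ∧ CAP+tail; G-an2-4 gates asym, D1 and
NE2/3/4).  Unit `b2b-balaban-t4-ne9-formalise-leaf-03` (gen 58 staged; gen 59 filed); NEW file importing (B2) `B9Eq321FlatProjectionDictionary` +
`B5Hk164Transl` + `B5DivOrth`; modifies nothing.  Net new unproved facts: 0.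
-/

noncomputable section

open scoped BigOperators InnerProductSpace ComplexConjugate Matrix

namespace Literature.MathematicalPhysics.QuantumFieldTheory.Balaban1983to89.B5Eq190FlatFormTransfer

open B4Sect5Torus (TSite)
open B9SectCLatticeCarrier (Bond DirPair)
open B9Eq319QprimeTorus (fineP)
open B9Eq311L2Pairing (WL2)
open B11Eq103H1Complex (BondL2K)
open B9Eq310HessianOperator (adTransportW principalOpK covCurlL2K equiv_covCurlL2K)
open B9Eq326OperatorAssembly (RofU)
open B9Eq34CovCurlVector (covCurl covCurl_apply)
open B9Eq33CovDerivVector (covGrad_apply_dir)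
open B9Eq315FlatDictionary (torCast_shift)
open B9Eq321FlatProjectionDictionary (sum_torCast)
open B5Eq172HodgePositivity (adTransportW_one re_inner_principalOpK_one)
open B5Prop11Plancherel (Tor fine unitVec)
open B5Action121 (Fs Fs_apply Fs_antisymm Fs_self)
open B5Hk164Transl (cEnergy cEnergy_eq)

variable {d : ℕ}

/-! ## §1 The flat plaquette field under the dictionary -/

section Curl

variable (P : Fin d → ℕ) [∀ i, NeZero (P i)]

/-- **THE CHAIN's FLAT PLAQUETTE FIELD (3.4) OF A PULLED-BACK BOND FUNCTION IS b05's `Fs` (1.2)** at the same scalar `c`: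
`(covCurl c id (A ∘ cast))(x, {μ < ν}) = Fs P c A μ ν (x mod P)`. [cite: Balaban1985BackgroundPropagators, (3.4) p.391; Balaban1984PropagatorsI, (1.2) p.18] -/
theorem covCurl_flat_pullback (c : ℂ) (A : Tor P × Fin d → ℂ) (x : TSite d P) (q : DirPair d) :
    covCurl c (fun _ : Bond d P => (LinearMap.id : ℂ →ₗ[ℂ] ℂ)) (fun b => A (fun i => ((b.1 i : ℕ) : ZMod (P i)), b.2)) (x, q) =
      Fs P c A q.1.1 q.1.2 (fun i => ((x i : ℕ) : ZMod (P i))) := by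
  rw [covCurl_apply, covGrad_apply_dir, covGrad_apply_dir, LinearMap.id_apply, LinearMap.id_apply, smul_eq_mul, smul_eq_mul, Fs_apply]
  dsimp only
  rw [torCast_shift, torCast_shift]
  ring

/-- `Fs` is linear in the scalar: `Fs c = (c/c′)·Fs c′` for `c′ ≠ 0`. [folklore] [cite: Balaban1984PropagatorsI, (1.2) p.18] -/
theorem Fs_rescale (c c' : ℂ) (hc' : c' ≠ 0) (A : Tor P × Fin d → ℂ) (μ ν : Fin d) (z : Tor P) :
    Fs P c A μ ν z = (c / c') * Fs P c' A μ ν z := by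
  rw [Fs_apply, Fs_apply, ← mul_assoc, div_mul_cancel₀ c hc']

end Curl

/-! ## §2 Pairs `μ < ν` against all ordered pairs -/

section Pairs

/-- A symmetric double sum over `Fin d × Fin d` with vanishing diagonal is twice the sum over the increasing pairs — the chain sums plaquettes over
`DirPair d = {μ < ν}` ((3.4)), b05 over all ordered pairs with the factor `½` of (1.21) «⟨∂A, ∂A⟩ = ½ Σ_{x∈T_η,μ,ν} η^d|F_{μν}(x)|²». [folklore]
[cite: Balaban1984PropagatorsI, (1.21) p.21; Balaban1985BackgroundPropagators, (3.4) p.391] -/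
theorem sum_dirPair_eq_half_sum (g : Fin d → Fin d → ℝ) (hsymm : ∀ μ ν, g μ ν = g ν μ) (hdiag : ∀ μ, g μ μ = 0) :
    ∑ q : DirPair d, g q.1.1 q.1.2 = (1 / 2 : ℝ) * ∑ μ, ∑ ν, g μ ν := by
  classical
  -- split the full sum by the trichotomy of the pair
  have hsplit : ∑ μ, ∑ ν, g μ ν =
      (∑ p ∈ (Finset.univ : Finset (Fin d × Fin d)).filter (fun p => p.1 < p.2), g p.1 p.2) +
      (∑ p ∈ (Finset.univ : Finset (Fin d × Fin d)).filter (fun p => p.2 < p.1), g p.1 p.2) := by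
    rw [← Finset.sum_product', Finset.univ_product_univ,
      ← Finset.sum_filter_add_sum_filter_not Finset.univ (fun p : Fin d × Fin d => p.1 < p.2)]
    congr 1
    rw [← Finset.sum_filter_add_sum_filter_not (Finset.univ.filter fun p : Fin d × Fin d => ¬ p.1 < p.2) (fun p => p.2 < p.1)]
    have h0 : ∑ p ∈ (Finset.univ.filter fun p : Fin d × Fin d => ¬ p.1 < p.2).filter (fun p => ¬ p.2 < p.1), g p.1 p.2 = 0 :=
      Finset.sum_eq_zero fun p hp => by
        simp only [Finset.mem_filter, Finset.mem_univ, true_and, not_lt] at hp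
        rw [le_antisymm hp.2 hp.1, hdiag]
    rw [h0, add_zero, Finset.filter_filter]
    refine Finset.sum_congr (Finset.filter_congr fun p _ => ?_) fun _ _ => rfl
    exact ⟨fun h => h.2, fun h => ⟨not_lt.2 h.le, h⟩⟩
  -- the two off-diagonal halves agree by the swap
  have hswap : (∑ p ∈ (Finset.univ : Finset (Fin d × Fin d)).filter (fun p => p.2 < p.1), g p.1 p.2) =
      ∑ p ∈ (Finset.univ : Finset (Fin d × Fin d)).filter (fun p => p.1 < p.2), g p.1 p.2 := by
    refine Finset.sum_nbij' (fun p => (p.2, p.1)) (fun p => (p.2, p.1)) ?_ ?_ ?_ ?_ ?_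
    · intro p hp; simp only [Finset.mem_filter, Finset.mem_univ, true_and] at hp ⊢; exact hp
    · intro p hp; simp only [Finset.mem_filter, Finset.mem_univ, true_and] at hp ⊢; exact hp
    · intro p _; rfl
    · intro p _; rfl
    · intro p _; exact hsymm _ _
  -- the increasing pairs are `DirPair d`
  have hsub : (∑ p ∈ (Finset.univ : Finset (Fin d × Fin d)).filter (fun p => p.1 < p.2), g p.1 p.2) = ∑ q : DirPair d, g q.1.1 q.1.2 := by
    rw [← Finset.sum_subtype_eq_sum_filter, Finset.subtype_univ]
  rw [hsplit, hswap, hsub]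
  ring

end Pairs

/-! ## §3 The first square: `re⟨f, D*D(1) f⟩ = c₀·(ηL)^{−2}·cEnergy` -/

section CurlEnergy

variable (L : ℕ) [NeZero L] (m : Fin d → ℕ) [∀ i, NeZero (m i)] [∀ i, NeZero (fineP L m i)] {c₀ : ℝ} [Fact (0 < c₀)]

/-- **THE CURL ENERGY OF THE CHAIN IS b05's `cEnergy`, UP TO THE WEIGHT `c₀` AND THE SCALING `(ηL)^{−2}`**: for a scalar bond function pulled back from
b05's torus, `re⟨f, D*D(1) f⟩ = c₀·(ηL)^{−2}·cEnergy L m A` — (3.10)'s first term `Σ_p η^d|(DA)(p)|²` at `U = 1` over the plaquettes `{μ < ν}`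
against (1.21)'s `½Σ_{x,μ,ν}|F_{μν}|²` at the scalar `n = L`. [cite: Balaban1985BackgroundPropagators, (3.10) p.392; Balaban1984PropagatorsI, (1.21) p.21, (1.69) p.29] -/
theorem re_inner_principalOpK_one_pullback (η : ℝ) (A : Tor (fine L m) × Fin d → ℂ) :
    RCLike.re ⟪(WL2.linearEquiv ℂ ℂ (fun _ : Bond d (fineP L m) => c₀)).symm
        (fun b => A (fun i => ((b.1 i : ℕ) : ZMod (fineP L m i)), b.2)),
      principalOpK (LinearEquiv.refl ℂ ℂ) η (fun _ : Bond d (fineP L m) => (1 : ℂˣ))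
        ((WL2.linearEquiv ℂ ℂ (fun _ : Bond d (fineP L m) => c₀)).symm
          (fun b => A (fun i => ((b.1 i : ℕ) : ZMod (fineP L m i)), b.2)))⟫_ℂ =
      c₀ * ((η * L)⁻¹) ^ 2 * cEnergy L m A := by
  have hL0 : (L : ℂ) ≠ 0 := by exact_mod_cast NeZero.ne L
  have hLr : (0 : ℝ) < L := by exact_mod_cast Nat.pos_of_ne_zero (NeZero.ne L)
  have hR : (adTransportW (LinearEquiv.refl ℂ ℂ) (fun _ : Bond d (fineP L m) => (1 : ℂˣ))) = fun _ => LinearMap.id :=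
    funext fun b => adTransportW_one _ b
  -- the scalar factor `‖η⁻¹/L‖² = (ηL)⁻²`
  have hfac : ‖((η : ℂ))⁻¹ / (L : ℂ)‖ ^ 2 = ((η * L)⁻¹) ^ 2 := by
    rw [norm_div, norm_inv, Complex.norm_real, Complex.norm_natCast, Real.norm_eq_abs, ← sq_abs (η * L)⁻¹, abs_inv, abs_mul,
      abs_of_pos hLr, div_eq_mul_inv, ← mul_inv]
  rw [re_inner_principalOpK_one, WL2.norm_sq (𝕜 := ℂ) (w := fun _ : B9SectCLatticeCarrier.Plaq d (fineP L m) => c₀) (V := ℂ), ← Finset.mul_sum]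
  -- pointwise: the plaquette value is `(η⁻¹/L)·Fs L A μ ν`
  have hpt : ∀ p : B9SectCLatticeCarrier.Plaq d (fineP L m),
      ‖WL2.equiv ℂ (fun _ : B9SectCLatticeCarrier.Plaq d (fineP L m) => c₀) ℂ
          (covCurlL2K ℂ c₀ ((η : ℂ))⁻¹ (adTransportW (LinearEquiv.refl ℂ ℂ) (fun _ : Bond d (fineP L m) => (1 : ℂˣ)))
            ((WL2.linearEquiv ℂ ℂ (fun _ : Bond d (fineP L m) => c₀)).symm
              (fun b => A (fun i => ((b.1 i : ℕ) : ZMod (fineP L m i)), b.2)))) p‖ ^ 2 =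
        ((η * L)⁻¹) ^ 2 * ‖Fs (fine L m) (L : ℂ) A p.2.1.1 p.2.1.2 (fun i => ((p.1 i : ℕ) : ZMod (fineP L m i)))‖ ^ 2 := fun p => by
    obtain ⟨x, q⟩ := p
    rw [equiv_covCurlL2K, hR, WL2.linearEquiv_symm_apply, Equiv.apply_symm_apply, covCurl_flat_pullback,
      Fs_rescale (fineP L m) _ (L : ℂ) hL0, norm_mul, mul_pow, hfac]
  simp only [hpt]
  rw [← Finset.mul_sum, Fintype.sum_prod_type,
    sum_torCast (fineP L m) (fun z => ∑ q : DirPair d, ‖Fs (fine L m) (L : ℂ) A q.1.1 q.1.2 z‖ ^ 2), cEnergy_eq]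
  rw [mul_assoc]
  congr 2
  rw [Finset.mul_sum]
  exact Finset.sum_congr rfl fun z _ => sum_dirPair_eq_half_sum (fun μ ν => ‖Fs (fine L m) (L : ℂ) A μ ν z‖ ^ 2)
    (fun μ ν => by rw [Fs_antisymm, norm_neg]) (fun μ => by rw [Fs_self, norm_zero]; simp)

end CurlEnergy

/-! ## §4 The averaging square: `‖Q(1)f‖² = c₁·Σ|Q_kA|²` -/

section AvgSquare

variable (L : ℕ) [NeZero L] (m : Fin d → ℕ) [∀ i, NeZero (m i)] [∀ i, NeZero (fineP L m i)] (hL : 1 ≤ L)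
  {α' : ℝ} (hα1' : α' ≤ 1 / 64)
  (hU1' : ∀ (x : B7Prop1Explicit.Site d) (κ : Fin d), B9Eq315QTorus.perCfg (fineP L m) (fun _ : Bond d (fineP L m) => (1 : ℂˣ)) x κ ∈ B7Prop1Explicit.U1 ℂ)
  (hreg' : ∀ (y : TSite d m) (κ : Fin d) (r : Fin d → Fin L),
    ‖((B7Prop1Explicit.Wcx L (B9Eq315QTorus.perCfg (fineP L m) (fun _ : Bond d (fineP L m) => (1 : ℂˣ))) (B9Eq315QTorus.cornerSite L y) κ
      (B7Prop1Explicit.boxVec L r) : ℂˣ) : ℂ) - 1‖ ≤ α')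
  {c₀ c₁ : ℝ} [Fact (0 < c₀)] [Fact (0 < c₁)]

omit [Fact (0 < c₀)] in
/-- **THE AVERAGING SQUARE**: `‖Q(1)f‖²_{L²(c₁)} = c₁·Σ_{(y,κ)} |(QvOp L m *ᵥ A)(y,κ)|²` for `f = A ∘ cast` (scalar fields, `φ = refl`; `Q(1) ↔ QvOp` by
`B9Eq315FlatDictionary.QvOp_mulVec_eq_QtorusLin_one`). [cite: Balaban1985BackgroundPropagators, (3.15)–(3.16) p.393; Balaban1984PropagatorsI, (1.18) p.20, (1.69) p.29] -/
theorem norm_sq_QtorusW_one_pullback (A : Tor (fine L m) × Fin d → ℂ) :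
    ‖B9Eq315QTorus.QtorusW L m hL (LinearEquiv.refl ℂ ℂ) (fun _ => 1) hα1' hU1' hreg' (c₁ := c₁)
        ((WL2.linearEquiv ℂ ℂ (fun _ : Bond d (fineP L m) => c₀)).symm (fun b => A (fun i => ((b.1 i : ℕ) : ZMod (fineP L m i)), b.2)))‖ ^ 2 =
      c₁ * ∑ w : Tor m × Fin d, ‖(B5Block118.QvOp L m).mulVec A w‖ ^ 2 := by
  rw [WL2.norm_sq (𝕜 := ℂ) (w := fun _ : Bond d m => c₁) (V := ℂ), ← Finset.mul_sum]
  congr 1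
  have hpt : ∀ c : Bond d m, WL2.equiv ℂ (fun _ : Bond d m => c₁) ℂ
      (B9Eq315QTorus.QtorusW L m hL (LinearEquiv.refl ℂ ℂ) (fun _ => 1) hα1' hU1' hreg' (c₁ := c₁)
        ((WL2.linearEquiv ℂ ℂ (fun _ : Bond d (fineP L m) => c₀)).symm (fun b => A (fun i => ((b.1 i : ℕ) : ZMod (fineP L m i)), b.2)))) c =
      (B5Block118.QvOp L m).mulVec A (fun i => ((c.1 i : ℕ) : ZMod (m i)), c.2) := fun c => by
    rw [B9Eq315QTorus.QtorusW_apply, WL2.linearEquiv_symm_apply, Equiv.apply_symm_apply, LinearEquiv.refl_symm, LinearEquiv.refl_apply,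
      B9Eq315FlatDictionary.QvOp_mulVec_eq_QtorusLin_one L m hL hα1' hU1' hreg' A c.1 c.2]
    rfl
  simp only [hpt]
  rw [Fintype.sum_prod_type, Fintype.sum_prod_type]
  exact sum_torCast m (fun z => ∑ κ : Fin d, ‖(B5Block118.QvOp L m).mulVec A (z, κ)‖ ^ 2)

end AvgSquare

/-! ## §5 The projected-divergence square: `‖R(1)D*f‖² = c₀·(ηL)^{−2}·Σ|R∂*A|²` -/

section DivSquare

variable (L : ℕ) [NeZero L] (m : Fin d → ℕ) [∀ i, NeZero (m i)] [∀ i, NeZero (fineP L m i)] {c₀ : ℝ} [Fact (0 < c₀)]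

omit [NeZero L] [∀ i, NeZero (m i)] [∀ i, NeZero (fineP L m i)] in
/-- The chain's `L²` letters are linear in their scalar: `D_{s·c} = s•D_c`, `D*_{s·c} = s•D*_c` (as the definitions (3.3)/(3.8) read here). [folklore]
[cite: Balaban1985BackgroundPropagators, (3.3) p.391, (3.8) p.392] -/
theorem covDerivL2K_scalar (s c : ℂ) (R : Bond d (fineP L m) → ℂ →ₗ[ℂ] ℂ) :
    B11Eq103H1Complex.covDerivL2K ℂ c₀ (s * c) R = s • B11Eq103H1Complex.covDerivL2K ℂ c₀ c R := by
  apply LinearMap.ext; intro f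
  apply (WL2.equiv ℂ (fun _ : Bond d (fineP L m) => c₀) ℂ).injective
  funext b
  rw [B11Eq103H1Complex.equiv_covDerivL2K, B9Eq33CovDerivVector.covDeriv_apply, LinearMap.smul_apply, WL2.equiv_smul, Pi.smul_apply,
    B11Eq103H1Complex.equiv_covDerivL2K, B9Eq33CovDerivVector.covDeriv_apply, smul_smul]

omit [NeZero L] [∀ i, NeZero (m i)] [∀ i, NeZero (fineP L m i)] in
/-- … and `D*`. [folklore] [cite: Balaban1985BackgroundPropagators, (3.8) p.392] -/
theorem covDivL2K_scalar (s c : ℂ) (S : Bond d (fineP L m) → ℂ →ₗ[ℂ] ℂ) :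
    B11Eq103H1Complex.covDivL2K ℂ c₀ (s * c) S = s • B11Eq103H1Complex.covDivL2K ℂ c₀ c S := by
  apply LinearMap.ext; intro f
  apply (WL2.equiv ℂ (fun _ : TSite d (fineP L m) => c₀) ℂ).injective
  funext x
  rw [B11Eq103H1Complex.equiv_covDivL2K, B9Eq33CovDerivVector.covDiv_apply, LinearMap.smul_apply, WL2.equiv_smul, Pi.smul_apply,
    B11Eq103H1Complex.equiv_covDivL2K, B9Eq33CovDerivVector.covDiv_apply, smul_smul]

omit [NeZero L] [∀ i, NeZero (m i)] [∀ i, NeZero (fineP L m i)] in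
/-- `Δ^{tc} = t²·Δ^c` for the chain's flat site Laplace operator (both letters linear in the scalar). [folklore] [cite: Balaban1985BackgroundPropagators, (3.23) p.394] -/
theorem covLaplaceSiteK_scalar (t c : ℂ) (R S : Bond d (fineP L m) → ℂ →ₗ[ℂ] ℂ) :
    B11Eq103H1Complex.covLaplaceSiteK (c₀ := c₀) (t * c) R S = (t * t) • B11Eq103H1Complex.covLaplaceSiteK (c₀ := c₀) c R S := by
  unfold B11Eq103H1Complex.covLaplaceSiteK
  rw [covDerivL2K_scalar, covDivL2K_scalar, LinearMap.smul_comp, LinearMap.comp_smul, smul_smul]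

omit [∀ i, NeZero (m i)] [∀ i, NeZero (fineP L m i)] in
/-- **`R(1)` DOES NOT DEPEND ON THE SCALAR `η`**: the subspace `Δ^η_1 N(Q′(1))` is the same for every `η ≠ 0` (`Δ^η = (η′/η)²·Δ^{η′}`, `Submodule.map_smul`),
hence so is the orthogonal projection onto it. [cite: Balaban1985BackgroundPropagators, (3.21)–(3.23) p.394] -/
theorem RofU_one_eq_of_ne_zero {η η' : ℝ} (hη : η ≠ 0) (hη' : η' ≠ 0) :
    RofU L m (LinearEquiv.refl ℂ ℂ) η (fun _ : Bond d (fineP L m) => (1 : ℂˣ)) (c₀ := c₀) =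
      RofU L m (LinearEquiv.refl ℂ ℂ) η' (fun _ : Bond d (fineP L m) => (1 : ℂˣ)) (c₀ := c₀) := by
  set t : ℂ := ((η : ℂ))⁻¹ * (η' : ℂ) with ht
  have ht0 : t ≠ 0 := mul_ne_zero (inv_ne_zero (Complex.ofReal_ne_zero.2 hη)) (Complex.ofReal_ne_zero.2 hη')
  have hsc : ((η : ℂ))⁻¹ = t * ((η' : ℂ))⁻¹ := by
    rw [ht, mul_assoc, mul_inv_cancel₀ (Complex.ofReal_ne_zero.2 hη'), mul_one]
  set R₁ := adTransportW (LinearEquiv.refl ℂ ℂ) (fun _ : Bond d (fineP L m) => (1 : ℂˣ)) with hR₁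
  set S₁ := adTransportW (LinearEquiv.refl ℂ ℂ) (fun b : Bond d (fineP L m) => ((fun _ : Bond d (fineP L m) => (1 : ℂˣ)) b)⁻¹) with hS₁
  set Q' := B9Eq326OperatorAssembly.QprimeW L m (LinearEquiv.refl ℂ ℂ) (fun _ : Bond d (fineP L m) => (1 : ℂˣ)) (c₀ := c₀) with hQ'
  have hΔ : B11Eq103H1Complex.covLaplaceSiteK (c₀ := c₀) ((η : ℂ))⁻¹ R₁ S₁ = (t * t) • B11Eq103H1Complex.covLaplaceSiteK (c₀ := c₀) ((η' : ℂ))⁻¹ R₁ S₁ := by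
    have h := congrArg (fun c => B11Eq103H1Complex.covLaplaceSiteK (c₀ := c₀) c R₁ S₁) hsc
    exact h.trans (covLaplaceSiteK_scalar L m t _ R₁ S₁)
  have hK : (LinearMap.ker Q').map (B11Eq103H1Complex.covLaplaceSiteK (c₀ := c₀) ((η : ℂ))⁻¹ R₁ S₁) =
      (LinearMap.ker Q').map (B11Eq103H1Complex.covLaplaceSiteK (c₀ := c₀) ((η' : ℂ))⁻¹ R₁ S₁) := by
    rw [hΔ, Submodule.map_smul _ _ _ (mul_ne_zero ht0 ht0)]
  haveI : CompleteSpace ((LinearMap.ker Q').map (B11Eq103H1Complex.covLaplaceSiteK (c₀ := c₀) ((η : ℂ))⁻¹ R₁ S₁)) := FiniteDimensional.complete ℂ _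
  haveI : CompleteSpace ((LinearMap.ker Q').map (B11Eq103H1Complex.covLaplaceSiteK (c₀ := c₀) ((η' : ℂ))⁻¹ R₁ S₁)) := FiniteDimensional.complete ℂ _
  apply LinearMap.ext
  intro u
  show B11Eq103H1Complex.projR _ Q' u = B11Eq103H1Complex.projR _ Q' u
  unfold B11Eq103H1Complex.projR
  rw [ContinuousLinearMap.coe_coe, ContinuousLinearMap.coe_coe]
  symm
  apply Submodule.eq_starProjection_of_mem_orthogonal
  · rw [← hK]
    exact Submodule.starProjection_apply_mem _ u
  · rw [← hK]
    exact Submodule.sub_starProjection_mem_orthogonal u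

-- (`Σ_x (∂*A)(x) = 0` is b05's `B5DivOrth.sum_GradOp_adjoint` — used below by name)

/-- **THE PROJECTED-DIVERGENCE SQUARE**: `‖R(1)(D*_{η⁻¹}(1) f)‖²_{L²(c₀)} = c₀·(ηL)^{−2}·Σ_x |(RdivS L m A)(x)|²` for `f = A ∘ cast` — `D* ↔ GradOpᴴ` ((B1) §5),
`R(1)` η-independent (above) and `= 1 − PcT` on the mean-zero divergence ((B2) at `η′ = L⁻¹`, where `PcT L m L` is b05's `RdivS` projection).
[cite: Balaban1985BackgroundPropagators, (3.21)–(3.26) pp.394–395; Balaban1984PropagatorsI, (1.69) p.29] -/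
theorem norm_sq_RofU_covDiv_pullback {η : ℝ} (hη : η ≠ 0) (A : Tor (fine L m) × Fin d → ℂ) :
    ‖RofU L m (LinearEquiv.refl ℂ ℂ) η (fun _ : Bond d (fineP L m) => (1 : ℂˣ)) (c₀ := c₀)
        (B11Eq103H1Complex.covDivL2K ℂ c₀ ((η : ℂ))⁻¹ (adTransportW (LinearEquiv.refl ℂ ℂ) fun _ : Bond d (fineP L m) => (1 : ℂˣ)⁻¹)
          ((WL2.linearEquiv ℂ ℂ (fun _ : Bond d (fineP L m) => c₀)).symm (fun b => A (fun i => ((b.1 i : ℕ) : ZMod (fineP L m i)), b.2))))‖ ^ 2 =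
      c₀ * ((η * L)⁻¹) ^ 2 * ∑ z, ‖B5Hk164Transl.RdivS L m A z‖ ^ 2 := by
  have hL0 : (L : ℂ) ≠ 0 := by exact_mod_cast NeZero.ne L
  have hLr : (0 : ℝ) < L := by exact_mod_cast Nat.pos_of_ne_zero (NeZero.ne L)
  have hLinv : ((L : ℝ)⁻¹) ≠ 0 := inv_ne_zero hLr.ne'
  -- the flat divergence at scalar `L`, pulled back
  set g : Tor (fine L m) → ℂ := (B5Action121.GradOp (fineP L m) (L : ℂ)).conjTranspose.mulVec A with hg
  have hg0 : ∑ z, g z = 0 := B5DivOrth.sum_GradOp_adjoint (fineP L m) (L : ℂ) A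
  have hS : (adTransportW (LinearEquiv.refl ℂ ℂ) fun _ : Bond d (fineP L m) => (1 : ℂˣ)⁻¹) = fun _ => LinearMap.id :=
    funext fun b => B5Eq172HodgePositivity.adTransportW_inv_one _ b
  have hDL : B11Eq103H1Complex.covDivL2K ℂ c₀ (L : ℂ) (adTransportW (LinearEquiv.refl ℂ ℂ) fun _ : Bond d (fineP L m) => (1 : ℂˣ)⁻¹)
        ((WL2.linearEquiv ℂ ℂ (fun _ : Bond d (fineP L m) => c₀)).symm (fun b => A (fun i => ((b.1 i : ℕ) : ZMod (fineP L m i)), b.2))) =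
      (WL2.linearEquiv ℂ ℂ (fun _ : TSite d (fineP L m) => c₀)).symm (fun x => g (fun i => ((x i : ℕ) : ZMod (fineP L m i)))) := by
    apply (WL2.equiv ℂ (fun _ : TSite d (fineP L m) => c₀) ℂ).injective
    funext x
    rw [B11Eq103H1Complex.equiv_covDivL2K, hS, WL2.linearEquiv_symm_apply, Equiv.apply_symm_apply, WL2.linearEquiv_symm_apply,
      Equiv.apply_symm_apply, hg, B9Eq315FlatDictionary.GradOp_conjTranspose_mulVec_eq_covDiv_flat (fineP L m) (L : ℂ) (by simp) A x]
  -- rescale the scalar `η⁻¹ = (η⁻¹/L)·L` and move `R(1)` to `η′ = L⁻¹`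
  have hsc : ((η : ℂ))⁻¹ = (((η : ℂ))⁻¹ / (L : ℂ)) * (L : ℂ) := by rw [div_mul_cancel₀ _ hL0]
  rw [hsc, covDivL2K_scalar, LinearMap.smul_apply, map_smul, hDL, RofU_one_eq_of_ne_zero L m hη hLinv,
    B9Eq321FlatProjectionDictionary.RofU_one_pullback_eq_one_sub_PcT L m hLinv g hg0, norm_smul, mul_pow,
    WL2.norm_sq (𝕜 := ℂ) (w := fun _ : TSite d (fineP L m) => c₀) (V := ℂ), ← Finset.mul_sum]
  have hLc : (((((L : ℝ)⁻¹ : ℝ) : ℂ))⁻¹) = (L : ℂ) := by push_cast; rw [inv_inv]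
  have hfac : ‖((η : ℂ))⁻¹ / (L : ℂ)‖ ^ 2 = ((η * L)⁻¹) ^ 2 := by
    rw [norm_div, norm_inv, Complex.norm_real, Complex.norm_natCast, Real.norm_eq_abs, ← sq_abs (η * L)⁻¹, abs_inv, abs_mul,
      abs_of_pos hLr, div_eq_mul_inv, ← mul_inv]
  rw [hfac, hLc]
  have hsum : ∑ x : TSite d (fineP L m), ‖WL2.equiv ℂ (fun _ : TSite d (fineP L m) => c₀) ℂ
      ((WL2.linearEquiv ℂ ℂ (fun _ : TSite d (fineP L m) => c₀)).symm
        (fun x => ((1 - B5Value126.PcT L m (L : ℂ)).mulVec g) (fun i => ((x i : ℕ) : ZMod (fineP L m i))))) x‖ ^ 2 =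
      ∑ z, ‖B5Hk164Transl.RdivS L m A z‖ ^ 2 := by
    simp only [WL2.linearEquiv_symm_apply, Equiv.apply_symm_apply]
    exact sum_torCast (fineP L m) (fun z => ‖((1 - B5Value126.PcT L m (L : ℂ)).mulVec g) z‖ ^ 2)
  rw [hsum]
  ring

end DivSquare

/-! ## §6 Assembly: (1.69) under the dictionary -/

section Transfer

variable (L : ℕ) [NeZero L] (m : Fin d → ℕ) [∀ i, NeZero (m i)] [∀ i, NeZero (fineP L m i)] (hL : 1 ≤ L)
  {α' : ℝ} (hα1' : α' ≤ 1 / 64)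
  (hU1' : ∀ (x : B7Prop1Explicit.Site d) (κ : Fin d), B9Eq315QTorus.perCfg (fineP L m) (fun _ : Bond d (fineP L m) => (1 : ℂˣ)) x κ ∈ B7Prop1Explicit.U1 ℂ)
  (hreg' : ∀ (y : TSite d m) (κ : Fin d) (r : Fin d → Fin L),
    ‖((B7Prop1Explicit.Wcx L (B9Eq315QTorus.perCfg (fineP L m) (fun _ : Bond d (fineP L m) => (1 : ℂˣ))) (B9Eq315QTorus.cornerSite L y) κ
      (B7Prop1Explicit.boxVec L r) : ℂˣ) : ℂ) - 1‖ ≤ α')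
  {c₀ c₁ : ℝ} [Fact (0 < c₀)] [Fact (0 < c₁)]

omit [NeZero L] [∀ i, NeZero (m i)] in
/-- The weighted `L²` norm of a pulled-back bond function: `‖A ∘ cast‖² = c₀·Σ_w ‖A w‖²`. [folklore] [cite: Balaban1985BackgroundPropagators, (3.11) p.392] -/
theorem norm_sq_pullback (A : Tor (fine L m) × Fin d → ℂ) :
    ‖(WL2.linearEquiv ℂ ℂ (fun _ : Bond d (fineP L m) => c₀)).symm (fun b => A (fun i => ((b.1 i : ℕ) : ZMod (fineP L m i)), b.2))‖ ^ 2 =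
      c₀ * ∑ w : Tor (fine L m) × Fin d, ‖A w‖ ^ 2 := by
  rw [WL2.norm_sq (𝕜 := ℂ) (w := fun _ : Bond d (fineP L m) => c₀) (V := ℂ), ← Finset.mul_sum]
  congr 1
  simp only [WL2.linearEquiv_symm_apply, Equiv.apply_symm_apply]
  rw [Fintype.sum_prod_type, Fintype.sum_prod_type]
  exact sum_torCast (fineP L m) (fun z => ∑ κ : Fin d, ‖A (z, κ)‖ ^ 2)

/-- **(1.69) UNDER THE DICTIONARY — THE FORM IDENTITY**: for a scalar bond function pulled back from b05's torus, the chain's flat principal gauge-fixed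
form `re⟨f, (D*D + D R(1) D* + aQ(1)†Q(1)) f⟩` equals `c₀(ηL)^{−2}·(cEnergy + Σ|R∂*A|²) + a·c₁·Σ|Q_kA|²` (the three squares of §3–§5 through
`B5Eq172HodgePositivity.re_inner_laplaceAK_projR`). [cite: Balaban1984PropagatorsI, (1.69) p.29; Balaban1985BackgroundPropagators, (3.26) p.395] -/
theorem re_inner_laplaceA_one_pullback {η : ℝ} (hη : η ≠ 0) (a : ℝ) (A : Tor (fine L m) × Fin d → ℂ) :
    RCLike.re ⟪(WL2.linearEquiv ℂ ℂ (fun _ : Bond d (fineP L m) => c₀)).symm (fun b => A (fun i => ((b.1 i : ℕ) : ZMod (fineP L m i)), b.2)),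
      B11Eq103H1Complex.laplaceALatticeK ((η : ℂ))⁻¹ (adTransportW (LinearEquiv.refl ℂ ℂ) (fun _ : Bond d (fineP L m) => (1 : ℂˣ)))
        (adTransportW (LinearEquiv.refl ℂ ℂ) fun _ : Bond d (fineP L m) => (1 : ℂˣ)⁻¹)
        (principalOpK (LinearEquiv.refl ℂ ℂ) η fun _ : Bond d (fineP L m) => (1 : ℂˣ))
        (RofU L m (LinearEquiv.refl ℂ ℂ) η (fun _ : Bond d (fineP L m) => (1 : ℂˣ)))
        (B9Eq315QTorus.QtorusW L m hL (LinearEquiv.refl ℂ ℂ) (fun _ => 1) hα1' hU1' hreg' (c₁ := c₁)) a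
        ((WL2.linearEquiv ℂ ℂ (fun _ : Bond d (fineP L m) => c₀)).symm (fun b => A (fun i => ((b.1 i : ℕ) : ZMod (fineP L m i)), b.2)))⟫_ℂ =
      c₀ * ((η * L)⁻¹) ^ 2 * cEnergy L m A + c₀ * ((η * L)⁻¹) ^ 2 * ∑ z, ‖B5Hk164Transl.RdivS L m A z‖ ^ 2 +
        a * (c₁ * ∑ w : Tor m × Fin d, ‖(B5Block118.QvOp L m).mulVec A w‖ ^ 2) := by
  have hc : (starRingEnd ℂ) ((η : ℂ))⁻¹ = ((η : ℂ))⁻¹ := B5Eq172HodgePositivity.conj_inv_ofReal η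
  have hRS := B5Eq172HodgePositivity.hRS_one (Pd := fineP L m) (LinearEquiv.refl ℂ ℂ) (𝔸 := ℂ)
  unfold RofU
  rw [B5Eq172HodgePositivity.laplaceALatticeK_RLatticeK_eq _ hc _ _ hRS, B5Eq172HodgePositivity.re_inner_laplaceAK_projR,
    B11Eq103H1Complex.adjoint_covDerivL2K _ hc _ _ hRS, re_inner_principalOpK_one_pullback, norm_sq_QtorusW_one_pullback]
  have hR : B11Eq103H1Complex.projR (B11Eq103H1Complex.covDivL2K ℂ c₀ ((η : ℂ))⁻¹ (adTransportW (LinearEquiv.refl ℂ ℂ) fun _ : Bond d (fineP L m) => (1 : ℂˣ)⁻¹) ∘ₗ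
        B11Eq103H1Complex.covDerivL2K ℂ c₀ ((η : ℂ))⁻¹ (adTransportW (LinearEquiv.refl ℂ ℂ) (fun _ : Bond d (fineP L m) => (1 : ℂˣ))))
      (B9Eq326OperatorAssembly.QprimeW L m (LinearEquiv.refl ℂ ℂ) (fun _ : Bond d (fineP L m) => (1 : ℂˣ)) (c₀ := c₀)) =
      RofU L m (LinearEquiv.refl ℂ ℂ) η (fun _ : Bond d (fineP L m) => (1 : ℂˣ)) (c₀ := c₀) := rfl
  rw [hR, norm_sq_RofU_covDiv_pullback L m hη]

end Transfer

end Literature.MathematicalPhysics.QuantumFieldTheory.Balaban1983to89.B5Eq190FlatFormTransfer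

end
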